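import Mathlib
import Summits.ValiantsHypothesis.ValiantsHypothesis.Theorems.LacunarySymmetroidMatrixDescartesDefiniteMomentsZonesExactWindow
import Summits.ValiantsHypothesis.ValiantsHypothesis.Theorems.LacunarySymmetroidMatrixDescartesDefiniteMomentsZonesCorollaries

/-!
# `MatrixDescartes` (stmt-ValiantsHypothesis-18050) — the DEFINITE-MOMENTS LAW, zones EXACT II: THE EXACT LACUNARY MARKUS
# THEOREM — on the intrinsic hyperbolic sector `det F` has EXACTLY `(K − 1)·m` positive roots counted with multiplicity,
# `m` in each spectral window, every root of multiplicity `dim ker`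

HONEST FRAMING.  Cell `pub-symmetroid`, seat `val-sym-mdr-p2` (gen 16); helper file `--supports` the crux
`Theses.LacunarySymmetroid.MatrixDescartes`, NO closure claim.  Completes the intrinsic-sector law of gens 14–15
(`card_posRoots_le_of_alternatingMoments` / `card_posRoots_le_of_rayleighSharp`: at most `(K−1)·m` DISTINCT positive zeros;
`card_posRoots_ge_of_rayleighSharp`: at least `K − 1`) to an EXACT statement; a sector law beside the crux; nothing here bears
on the crux in its window, on `stub_twoSided`, on `DoorA26`/`DoorA34`, registers, or `VP ≠ VNP`.

THEOREM (`card_posRoots_multiset_eq_of_alternatingScales`, `…_of_rayleighSharp`).  `F(x) = ∑ₗ x^{dₗ} Sₗ` with `K ≥ 2` real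
symmetric `m × m` letters; suppose `F` is DEFINITE WITH ALTERNATING SIGNS at `K` scales `0 < a₀ < ⋯ < a_{K−1}`
(equivalently, for strictly increasing exponents, every Rayleigh `K`-nomial `P_v = ∑ₗ (vᵀSₗv)X^{dₗ}`, `v ≠ 0`, has `K − 1`
positive roots: the intrinsic hyperbolic sector, gen 15 `rayleighSharp_iff_alternatingScales`).  Then
(i) every window `(aⱼ, aⱼ₊₁)` carries EXACTLY `m` roots of `det F` COUNTED WITH MULTIPLICITY (`card_roots_gap_eq`) and kernels
of total dimension exactly `m` (`sum_corank_gap_eq`); (ii) every positive root `t` has multiplicity EXACTLY `dim ker F(t)`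
(`rootMultiplicity_eq_corank_of_alternatingScales`: all eigenvalues are SEMISIMPLE OF DEFINITE TYPE); (iii) in total `det F`
has EXACTLY `(K − 1)·m` positive roots counted with multiplicity — DESCARTES' RULE OF SIGNS IS AN EQUALITY, WITH MULTIPLICITY
`m`, ON THE HYPERBOLIC SECTOR (the lacunary real-symmetric form of Markus' theorem that a hyperbolic pencil of degree `ℓ` has
real semisimple spectrum with `n` eigenvalues in each of its `ℓ` spectral zones: A.S. Markus, Introduction to the spectral
theory of polynomial operator pencils, AMS 1988, §31; for hyperbolic matrix polynomials cf. [cite: CameronPsarrakos2019, Thm 3]).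
INGREDIENTS: Descartes with multiplicity makes every Rayleigh zero simple (gen 15 `sharp_multiset`), so kernel vectors are of
definite type and the first-order multiplicity law (`Multiplicity.rootMultiplicity_det_pencil_eq_corank`, gen 16) gives
`mult = dim ker`; the window count is `DefiniteMoments.card_roots_window_eq` (directed Sylvester climb + inertia-jump bound).
[folklore]; axioms standard; no definitions.
-/

-- layout Summits/ValiantsHypothesis/ValiantsHypothesis forces the duplicated namespace component
set_option linter.dupNamespace false

namespace Summit.ValiantsHypothesis.ValiantsHypothesis.Theorems.LacunarySymmetroidMatrixDescartes

open Polynomial Matrix Finset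
open scoped BigOperators Topology

namespace DefiniteMoments

variable {ι : Type} [Fintype ι] [DecidableEq ι]

/-! ## §1 Rayleigh zeros of a Rayleigh-sharp pencil are simple -/

omit [DecidableEq ι] in
/-- **Simple Rayleigh zeros.**  On a Rayleigh-sharp pencil, at every positive zero `x` of a Rayleigh `K`-nomial `P_v`
(`v ≠ 0`) the derivative does not vanish: `P_v′(x) ≠ 0` (Descartes with multiplicity, gen 15 `sharp_multiset`). [folklore] -/
theorem eval_derivative_ne_zero_of_sharp {K : ℕ} (hK : 2 ≤ K) (d : Fin K → ℕ) (S : Fin K → Matrix ι ι ℝ)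
    (hsharp : ∀ v : ι → ℝ, v ≠ 0 →
      K ≤ ((∑ l, C (v ⬝ᵥ (S l *ᵥ v)) * (X : ℝ[X]) ^ d l).roots.toFinset.filter (fun t => 0 < t)).card + 1)
    (v : ι → ℝ) (hv : v ≠ 0) {x : ℝ} (hx : 0 < x) (hroot : v ⬝ᵥ ((∑ k, x ^ d k • S k) *ᵥ v) = 0) :
    (derivative (∑ l, C (v ⬝ᵥ (S l *ᵥ v)) * (X : ℝ[X]) ^ d l)).eval x ≠ 0 := by
  set P := ∑ l, C (v ⬝ᵥ (S l *ᵥ v)) * (X : ℝ[X]) ^ d l with hP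
  have hP0 : P ≠ 0 := rayleighPoly_ne_zero_of_sharp hK d S hsharp v hv
  have hle : P.rootMultiplicity x ≤ 1 := rootMultiplicity_le_one_of_sharp P (sharp_multiset hK d S hsharp v hv) hx
  have hisroot : P.IsRoot x := by rw [IsRoot, hP, eval_rayleighPoly]; exact hroot
  have hge : 0 < P.rootMultiplicity x := (rootMultiplicity_pos hP0).2 hisroot
  have hone : P.rootMultiplicity x = 1 := le_antisymm hle hge
  have h := eval_divByMonic_pow_rootMultiplicity_ne_zero x hP0
  rw [hone, pow_one, Multiplicity.eval_divByMonic_eq_eval_derivative hisroot] at h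
  exact h

/-! ## §2 Alternating scales: the exact count in each window -/

section Scales

variable {K : ℕ}

omit [DecidableEq ι] in
/-- The Descartes budget in gap form: every Rayleigh form (`v ≠ 0`) vanishes at no more than `K − 1` distinct positive
points. [folklore] -/
theorem budget_of_alternatingScales (hK : 2 ≤ K) (d : Fin K → ℕ) (S : Fin K → Matrix ι ι ℝ)
    (a : Fin (K - 1 + 1) → ℝ) (σ : ℝ)
    (hdef : ∀ (j : Fin (K - 1 + 1)) (v : ι → ℝ), v ≠ 0 →
      0 < σ * (-1) ^ (j : ℕ) * (v ⬝ᵥ ((∑ k, a j ^ d k • S k) *ᵥ v)))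
    (v : ι → ℝ) (hv : v ≠ 0) (T : Finset ℝ)
    (hT : ∀ r ∈ T, 0 < r ∧ v ⬝ᵥ ((∑ k, r ^ d k • S k) *ᵥ v) = 0) : T.card ≤ K - 1 := by
  have hx₀ : v ⬝ᵥ ((∑ k, a 0 ^ d k • S k) *ᵥ v) ≠ 0 := by
    intro h
    have h0 := hdef 0 v hv
    rw [h, mul_zero] at h0
    exact lt_irrefl 0 h0
  have h := rayleigh_budget d S v hx₀ T hT
  rw [Fintype.card_fin] at h
  omega

omit [DecidableEq ι] in
/-- The two ends of gap `i` are definite of opposite signs, with the common sign factor `σ(−1)ⁱ`. [folklore] -/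
theorem gap_ends (d : Fin K → ℕ) (S : Fin K → Matrix ι ι ℝ) (a : Fin (K - 1 + 1) → ℝ) (σ : ℝ)
    (hdef : ∀ (j : Fin (K - 1 + 1)) (v : ι → ℝ), v ≠ 0 →
      0 < σ * (-1) ^ (j : ℕ) * (v ⬝ᵥ ((∑ k, a j ^ d k • S k) *ᵥ v))) (i : Fin (K - 1)) :
    (∀ v : ι → ℝ, v ≠ 0 → 0 < σ * (-1) ^ (i : ℕ) * (v ⬝ᵥ ((∑ k, a i.castSucc ^ d k • S k) *ᵥ v))) ∧
      ∀ v : ι → ℝ, v ≠ 0 → σ * (-1) ^ (i : ℕ) * (v ⬝ᵥ ((∑ k, a i.succ ^ d k • S k) *ᵥ v)) < 0 := by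
  constructor
  · intro v hv
    have h := hdef i.castSucc v hv
    rwa [Fin.val_castSucc] at h
  · intro v hv
    have h := hdef i.succ v hv
    rw [Fin.val_succ, pow_succ] at h
    have e : σ * ((-1) ^ (i : ℕ) * -1) * (v ⬝ᵥ ((∑ k, a i.succ ^ d k • S k) *ᵥ v))
        = -(σ * (-1) ^ (i : ℕ) * (v ⬝ᵥ ((∑ k, a i.succ ^ d k • S k) *ᵥ v))) := by ring
    rw [e] at h
    linarith

omit [DecidableEq ι] in
/-- One zero per gap for every Rayleigh form. [folklore] -/
theorem gap_hone (hK : 2 ≤ K) (d : Fin K → ℕ) (S : Fin K → Matrix ι ι ℝ) (a : Fin (K - 1 + 1) → ℝ)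
    (ha : StrictMono a) (ha0 : 0 < a 0) (σ : ℝ)
    (hdef : ∀ (j : Fin (K - 1 + 1)) (v : ι → ℝ), v ≠ 0 →
      0 < σ * (-1) ^ (j : ℕ) * (v ⬝ᵥ ((∑ k, a j ^ d k • S k) *ᵥ v))) (i : Fin (K - 1))
    (v : ι → ℝ) (hv : v ≠ 0) (r₁ r₂ : ℝ) (h1 : a i.castSucc < r₁) (h1' : r₁ < a i.succ) (h2 : a i.castSucc < r₂)
    (h2' : r₂ < a i.succ) (hf1 : v ⬝ᵥ ((∑ k, r₁ ^ d k • S k) *ᵥ v) = 0)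
    (hf2 : v ⬝ᵥ ((∑ k, r₂ ^ d k • S k) *ᵥ v) = 0) : r₁ = r₂ := by
  obtain ⟨z, hz, hall⟩ := gapZeros d S a ha ha0 σ hdef (budget_of_alternatingScales hK d S a σ hdef) v hv
  have hpos : ∀ r, a i.castSucc < r → 0 < r := fun r hr => (ha0.trans_le (ha.monotone (Fin.zero_le _))).trans hr
  obtain ⟨i₁, rfl⟩ := hall r₁ (hpos r₁ h1) hf1
  obtain ⟨i₂, rfl⟩ := hall r₂ (hpos r₂ h2) hf2
  have e₁ : i₁ = i := gap_eq_of_mem a ha i₁ i (z i₁) (hz i₁).1 (hz i₁).2.1 h1 h1'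
  have e₂ : i₂ = i := gap_eq_of_mem a ha i₂ i (z i₂) (hz i₂).1 (hz i₂).2.1 h2 h2'
  rw [e₁, e₂]

/-- **EXACT KERNEL COUNT IN EACH GAP**: `K` alternating definite scales ⇒ the kernels of `F` at the roots of `det F` in
`(aᵢ, aᵢ₊₁)` have total dimension EXACTLY `card ι`. [folklore] -/
theorem sum_corank_gap_eq (hK : 2 ≤ K) (d : Fin K → ℕ) (S : Fin K → Matrix ι ι ℝ) (hS : ∀ k, (S k).IsSymm)
    (a : Fin (K - 1 + 1) → ℝ) (ha : StrictMono a) (ha0 : 0 < a 0) (σ : ℝ)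
    (hdef : ∀ (j : Fin (K - 1 + 1)) (v : ι → ℝ), v ≠ 0 →
      0 < σ * (-1) ^ (j : ℕ) * (v ⬝ᵥ ((∑ k, a j ^ d k • S k) *ᵥ v))) (i : Fin (K - 1)) :
    ∑ t ∈ (Matrix.det (∑ k, ((X : ℝ[X]) ^ d k) • (S k).map C)).roots.toFinset.filter
        (fun t => a i.castSucc < t ∧ t < a i.succ), (Fintype.card ι - (∑ k, t ^ d k • S k).rank)
      = Fintype.card ι := by
  obtain ⟨hFa, hFb⟩ := gap_ends d S a σ hdef i
  exact sum_corank_window_eq d S hS (ha (Fin.castSucc_lt_succ)) _ hFa hFb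
    (gap_hone hK d S a ha ha0 σ hdef i)

/-- **EXACT ROOT COUNT IN EACH GAP, WITH MULTIPLICITY**: `K` alternating definite scales ⇒ `det F` has EXACTLY `card ι`
roots in `(aᵢ, aᵢ₊₁)` counted with multiplicity. [folklore] -/
theorem card_roots_gap_eq (hK : 2 ≤ K) (d : Fin K → ℕ) (S : Fin K → Matrix ι ι ℝ) (hS : ∀ k, (S k).IsSymm)
    (a : Fin (K - 1 + 1) → ℝ) (ha : StrictMono a) (ha0 : 0 < a 0) (σ : ℝ)
    (hdef : ∀ (j : Fin (K - 1 + 1)) (v : ι → ℝ), v ≠ 0 →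
      0 < σ * (-1) ^ (j : ℕ) * (v ⬝ᵥ ((∑ k, a j ^ d k • S k) *ᵥ v))) (i : Fin (K - 1)) :
    Multiset.card ((Matrix.det (∑ k, ((X : ℝ[X]) ^ d k) • (S k).map C)).roots.filter
        (fun t => a i.castSucc < t ∧ t < a i.succ)) = Fintype.card ι := by
  obtain ⟨hFa, hFb⟩ := gap_ends d S a σ hdef i
  have hsharp := rayleighSharp_of_alternatingScales hK d S a ha ha0 σ hdef
  refine card_roots_window_eq d S hS (ha (Fin.castSucc_lt_succ)) _ hFa hFb
    (gap_hone hK d S a ha ha0 σ hdef i) fun v hv x hx _ hfx => ?_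
  exact eval_derivative_ne_zero_of_sharp hK d S hsharp v hv
    ((ha0.trans_le (ha.monotone (Fin.zero_le _))).trans hx) hfx

/-- **Semisimple spectrum of definite type**: `K` alternating definite scales ⇒ every positive root `t` of `det F` has
multiplicity EXACTLY `dim ker F(t)`. [folklore] -/
theorem rootMultiplicity_eq_corank_of_alternatingScales (hK : 2 ≤ K) (d : Fin K → ℕ) (S : Fin K → Matrix ι ι ℝ)
    (hS : ∀ k, (S k).IsSymm) (a : Fin (K - 1 + 1) → ℝ) (ha : StrictMono a) (ha0 : 0 < a 0) (σ : ℝ)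
    (hdef : ∀ (j : Fin (K - 1 + 1)) (v : ι → ℝ), v ≠ 0 →
      0 < σ * (-1) ^ (j : ℕ) * (v ⬝ᵥ ((∑ k, a j ^ d k • S k) *ᵥ v))) {t : ℝ} (ht : 0 < t) :
    (Matrix.det (∑ k, ((X : ℝ[X]) ^ d k) • (S k).map C)).rootMultiplicity t
      = Fintype.card ι - (∑ k, t ^ d k • S k).rank := by
  have hsharp := rayleighSharp_of_alternatingScales hK d S a ha ha0 σ hdef
  exact (Multiplicity.rootMultiplicity_det_pencil_eq_corank d S hS t fun v hv hv0 =>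
    eval_derivative_ne_zero_of_sharp hK d S hsharp v hv0 ht (by rw [hv, dotProduct_zero])).2

omit [Fintype ι] [DecidableEq ι] in
/-- Cardinality of a filtered multiset through the counts of its distinct elements. [folklore] -/
theorem card_filter_eq_sum_count (M : Multiset ℝ) (p : ℝ → Prop) [DecidablePred p] :
    Multiset.card (M.filter p) = ∑ t ∈ M.toFinset.filter p, M.count t := by
  classical
  rw [← Multiset.toFinset_sum_count_eq, Multiset.toFinset_filter]
  exact Finset.sum_congr rfl fun t ht => by rw [Multiset.count_filter_of_pos (Finset.mem_filter.1 ht).2]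

/-- **THE EXACT LACUNARY MARKUS THEOREM (alternating-scales form).**  `K ≥ 2` real symmetric letters; `F` definite with
alternating signs at `K` scales `0 < a₀ < ⋯ < a_{K−1}`.  Then `det (∑ₗ X^{dₗ} Sₗ)` has EXACTLY `(K − 1)·card ι` positive roots
COUNTED WITH MULTIPLICITY. [folklore] -/
theorem card_posRoots_multiset_eq_of_alternatingScales (hK : 2 ≤ K) (d : Fin K → ℕ) (S : Fin K → Matrix ι ι ℝ)
    (hS : ∀ k, (S k).IsSymm) (a : Fin (K - 1 + 1) → ℝ) (ha : StrictMono a) (ha0 : 0 < a 0) (σ : ℝ)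
    (hdef : ∀ (j : Fin (K - 1 + 1)) (v : ι → ℝ), v ≠ 0 →
      0 < σ * (-1) ^ (j : ℕ) * (v ⬝ᵥ ((∑ k, a j ^ d k • S k) *ᵥ v))) :
    Multiset.card ((Matrix.det (∑ k, ((X : ℝ[X]) ^ d k) • (S k).map C)).roots.filter (fun t => 0 < t))
      = (K - 1) * Fintype.card ι := by
  classical
  set P := Matrix.det (∑ k, ((X : ℝ[X]) ^ d k) • (S k).map C) with hP
  have hbudget := budget_of_alternatingScales hK d S a σ hdef
  -- the positive roots split over the gaps
  have hunion : P.roots.toFinset.filter (fun t => 0 < t)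
      = (Finset.univ : Finset (Fin (K - 1))).biUnion
          (fun i => P.roots.toFinset.filter (fun t => a i.castSucc < t ∧ t < a i.succ)) := by
    ext x
    rw [Finset.mem_filter, Finset.mem_biUnion]
    constructor
    · rintro ⟨hxr, hx0⟩
      obtain ⟨i, hi1, hi2⟩ := posRoot_mem_gap d S (K - 1) a ha ha0 σ hdef hbudget hx0 (det_eval_eq_zero_of_mem d S hxr)
      exact ⟨i, Finset.mem_univ _, Finset.mem_filter.2 ⟨hxr, hi1, hi2⟩⟩
    · rintro ⟨i, -, hx⟩
      obtain ⟨hxr, hi1, -⟩ := Finset.mem_filter.1 hx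
      exact ⟨hxr, (ha0.trans_le (ha.monotone (Fin.zero_le _))).trans hi1⟩
  have hdisj : ((Finset.univ : Finset (Fin (K - 1))) : Set (Fin (K - 1))).PairwiseDisjoint
      (fun i : Fin (K - 1) => P.roots.toFinset.filter (fun t => a i.castSucc < t ∧ t < a i.succ)) := by
    intro i _ i' _ hne
    rw [Function.onFun, Finset.disjoint_left]
    intro x hx hx'
    obtain ⟨-, h1, h2⟩ := Finset.mem_filter.1 hx
    obtain ⟨-, h3, h4⟩ := Finset.mem_filter.1 hx'
    exact hne (gap_eq_of_mem a ha i i' x h1 h2 h3 h4)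
  rw [card_filter_eq_sum_count, hunion, Finset.sum_biUnion hdisj]
  have hgap : ∀ i : Fin (K - 1), ∑ t ∈ P.roots.toFinset.filter (fun t => a i.castSucc < t ∧ t < a i.succ),
      P.roots.count t = Fintype.card ι := fun i => by
    rw [← card_filter_eq_sum_count]; exact card_roots_gap_eq hK d S hS a ha ha0 σ hdef i
  rw [Finset.sum_congr rfl fun i _ => hgap i, Finset.sum_const, Finset.card_univ, Fintype.card_fin, smul_eq_mul]

/-- **Kernel-dimension form**: the kernels at all positive roots have total dimension EXACTLY `(K − 1)·card ι`. [folklore] -/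
theorem sum_corank_posRoots_eq_of_alternatingScales (hK : 2 ≤ K) (d : Fin K → ℕ) (S : Fin K → Matrix ι ι ℝ)
    (hS : ∀ k, (S k).IsSymm) (a : Fin (K - 1 + 1) → ℝ) (ha : StrictMono a) (ha0 : 0 < a 0) (σ : ℝ)
    (hdef : ∀ (j : Fin (K - 1 + 1)) (v : ι → ℝ), v ≠ 0 →
      0 < σ * (-1) ^ (j : ℕ) * (v ⬝ᵥ ((∑ k, a j ^ d k • S k) *ᵥ v))) :
    ∑ t ∈ (Matrix.det (∑ k, ((X : ℝ[X]) ^ d k) • (S k).map C)).roots.toFinset.filter (fun t => 0 < t),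
        (Fintype.card ι - (∑ k, t ^ d k • S k).rank) = (K - 1) * Fintype.card ι := by
  classical
  rw [← card_posRoots_multiset_eq_of_alternatingScales hK d S hS a ha ha0 σ hdef, card_filter_eq_sum_count]
  refine Finset.sum_congr rfl fun t ht => ?_
  rw [count_roots, rootMultiplicity_eq_corank_of_alternatingScales hK d S hS a ha ha0 σ hdef (Finset.mem_filter.1 ht).2]

end Scales

/-! ## §3 The Rayleigh-sharp (intrinsic) form -/

/-- **THE EXACT LACUNARY MARKUS THEOREM (intrinsic form).**  `K ≥ 2` real symmetric `ι × ι` letters at strictly increasing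
exponents; if every Rayleigh `K`-nomial `∑ₗ (vᵀSₗv)X^{dₗ}` (`v ≠ 0`) has `K − 1` distinct positive roots, then
`det (∑ₗ X^{dₗ} Sₗ)` has EXACTLY `(K − 1)·card ι` positive roots COUNTED WITH MULTIPLICITY — Descartes' rule of signs holds
with EQUALITY, multiplicity `m`, on the intrinsic hyperbolic sector. [folklore] -/
theorem card_posRoots_multiset_eq_of_rayleighSharp {K : ℕ} (hK : 2 ≤ K) (d : Fin K → ℕ) (hd : StrictMono d)
    (S : Fin K → Matrix ι ι ℝ) (hS : ∀ l, (S l).IsSymm)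
    (hsharp : ∀ v : ι → ℝ, v ≠ 0 →
      K ≤ ((∑ l, C (v ⬝ᵥ (S l *ᵥ v)) * (X : ℝ[X]) ^ d l).roots.toFinset.filter (fun t => 0 < t)).card + 1) :
    Multiset.card ((Matrix.det (∑ k, ((X : ℝ[X]) ^ d k) • (S k).map C)).roots.filter (fun t => 0 < t))
      = (K - 1) * Fintype.card ι := by
  obtain ⟨a, σ, ha, ha0, -, hdef⟩ := exists_alternatingScales_of_rayleighSharp hK d hd S hS hsharp
  exact card_posRoots_multiset_eq_of_alternatingScales hK d S hS a ha ha0 σ hdef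

/-- **Semisimplicity on the sector (intrinsic form)**: every positive root `t` of `det F` has multiplicity EXACTLY
`dim ker F(t)`. [folklore] -/
theorem rootMultiplicity_eq_corank_of_rayleighSharp {K : ℕ} (hK : 2 ≤ K) (d : Fin K → ℕ)
    (S : Fin K → Matrix ι ι ℝ) (hS : ∀ l, (S l).IsSymm)
    (hsharp : ∀ v : ι → ℝ, v ≠ 0 →
      K ≤ ((∑ l, C (v ⬝ᵥ (S l *ᵥ v)) * (X : ℝ[X]) ^ d l).roots.toFinset.filter (fun t => 0 < t)).card + 1)
    {t : ℝ} (ht : 0 < t) :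
    (Matrix.det (∑ k, ((X : ℝ[X]) ^ d k) • (S k).map C)).rootMultiplicity t
      = Fintype.card ι - (∑ k, t ^ d k • S k).rank :=
  (Multiplicity.rootMultiplicity_det_pencil_eq_corank d S hS t fun v hv hv0 =>
    eval_derivative_ne_zero_of_sharp hK d S hsharp v hv0 ht (by rw [hv, dotProduct_zero])).2

/-- **Kernel-dimension form (intrinsic)**: `∑_{t > 0, det F(t) = 0} dim ker F(t) = (K − 1)·card ι`. [folklore] -/
theorem sum_corank_posRoots_eq_of_rayleighSharp {K : ℕ} (hK : 2 ≤ K) (d : Fin K → ℕ) (hd : StrictMono d)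
    (S : Fin K → Matrix ι ι ℝ) (hS : ∀ l, (S l).IsSymm)
    (hsharp : ∀ v : ι → ℝ, v ≠ 0 →
      K ≤ ((∑ l, C (v ⬝ᵥ (S l *ᵥ v)) * (X : ℝ[X]) ^ d l).roots.toFinset.filter (fun t => 0 < t)).card + 1) :
    ∑ t ∈ (Matrix.det (∑ k, ((X : ℝ[X]) ^ d k) • (S k).map C)).roots.toFinset.filter (fun t => 0 < t),
        (Fintype.card ι - (∑ k, t ^ d k • S k).rank) = (K - 1) * Fintype.card ι := by
  obtain ⟨a, σ, ha, ha0, -, hdef⟩ := exists_alternatingScales_of_rayleighSharp hK d hd S hS hsharp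
  exact sum_corank_posRoots_eq_of_alternatingScales hK d S hS a ha ha0 σ hdef

/-- **Distinct versus counted**: on the sector the number of DISTINCT positive roots equals `(K − 1)·card ι` exactly when
every positive root has a one-dimensional kernel (all roots simple); in general it falls short of `(K − 1)·card ι` by the
total excess kernel dimension `∑ (dim ker F(t) − 1)`. [folklore] -/
theorem card_posRoots_add_excess_eq_of_rayleighSharp {K : ℕ} (hK : 2 ≤ K) (d : Fin K → ℕ) (hd : StrictMono d)
    (S : Fin K → Matrix ι ι ℝ) (hS : ∀ l, (S l).IsSymm)
    (hsharp : ∀ v : ι → ℝ, v ≠ 0 →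
      K ≤ ((∑ l, C (v ⬝ᵥ (S l *ᵥ v)) * (X : ℝ[X]) ^ d l).roots.toFinset.filter (fun t => 0 < t)).card + 1) :
    ((Matrix.det (∑ k, ((X : ℝ[X]) ^ d k) • (S k).map C)).roots.toFinset.filter (fun t => 0 < t)).card
      + ∑ t ∈ (Matrix.det (∑ k, ((X : ℝ[X]) ^ d k) • (S k).map C)).roots.toFinset.filter (fun t => 0 < t),
          (Fintype.card ι - (∑ k, t ^ d k • S k).rank - 1) = (K - 1) * Fintype.card ι := by
  classical
  set P := Matrix.det (∑ k, ((X : ℝ[X]) ^ d k) • (S k).map C) with hP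
  rw [← sum_corank_posRoots_eq_of_rayleighSharp hK d hd S hS hsharp, Finset.card_eq_sum_ones, ← Finset.sum_add_distrib]
  refine Finset.sum_congr rfl fun t ht => ?_
  obtain ⟨htr, ht0⟩ := Finset.mem_filter.1 ht
  -- at a root the kernel is non-trivial, so `corank ≥ 1`
  have hP0 : P ≠ 0 := (Multiplicity.rootMultiplicity_det_pencil_eq_corank d S hS t fun v hv hv0 =>
    eval_derivative_ne_zero_of_sharp hK d S hsharp v hv0 ht0 (by rw [hv, dotProduct_zero])).1
  have hmult : 1 ≤ Fintype.card ι - (∑ k, t ^ d k • S k).rank := by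
    rw [← rootMultiplicity_eq_corank_of_rayleighSharp hK d S hS hsharp ht0]
    exact (rootMultiplicity_pos hP0).2 ((mem_roots hP0).1 (Multiset.mem_toFinset.1 htr))
  omega

end DefiniteMoments

end Summit.ValiantsHypothesis.ValiantsHypothesis.Theorems.LacunarySymmetroidMatrixDescartes
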